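import Mathlib
import Summits.CriticalPhenomena.SAWScalingLimit.Theorems.SAWRestrictionRigidityAxiomsOfLimitMarkovIntrinsicClock
import Summits.CriticalPhenomena.SAWScalingLimit.Theorems.SAWRestrictionRigidityAxiomsOfLimitMarkovStrictExtension
import Literature.Probability.RandomPlanarGeometry.CurveClassStopAtMeasurable
import HarnessLib

/-!
# The clock parametrisation of planar curves

Continuity, reparametrisation invariance, measurability.

Crux `AxiomsOfLimit` (stmt-CriticalPhenomena-1370), line `registered`, stub `stub_markovOfLimit`:
soft-Markov brick Λb1 "clock parametrisation of parametrised curves: continuity,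
reparametrisation invariance, measurability" (lead c4); registered sub-stub `stub_clockInverse`.
Theorems only.

Fix a radius `R > 0`, put `W := volume (closedBall 0 R)` and let
`clk γ s := ∫ x in closedBall 0 R, exp (-infDist x (γ ∘ affineClamp 0 s).range)` be the intrinsic
clock of the head `γ|[0, s]` of a curve `γ` (file `…IntrinsicClock`). The shifted clock
`s ↦ clk γ s - clk γ 0` is continuous, nondecreasing, and `< W`; through its generalised inverse
`θ r := sInf {s | r W ≤ clk γ s - clk γ 0}` (an `sInf` in the complete lattice `unitInterval`)
one defines the CLOCK PARAMETRISATION `Λ γ r := γ (θ r)`. This file proves: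

* (A) for a simple curve inside `ball 0 R` the shifted clock is strictly increasing, so `θ` is a
  monotone surjection of `[0, 1]` onto itself, hence continuous, with `θ 0 = 0`, `θ 1 = 1`
  (`ClockInverse.exists_theta`);
* (B) `Λ` is invariant under continuous monotone reparametrisations `ψ` of `[0, 1]` fixing the
  endpoints: the head of `γ ∘ ψ` at `s` has the range of the head of `γ` at `ψ s`, so the clocks
  agree after `ψ`, and `ψ` maps the generalised inverse of the reparametrised clock to that of the
  original one (`ClockInverse.apply_sInf_preimage`);
* (C) at a fixed `r`, `γ ↦ Λ γ r` is Borel on `C([0,1], ℂ)`: the clock is continuous in `γ`, the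
  sets `{γ | sInf {…} < b}` are countable unions over rational-like parameters of closed sets, and
  evaluation is jointly continuous (`ClockInverse.measurable_sInf`).

They are assembled in `stub_clockInverse`.

References: M. Aizenman, A. Burchard, Duke Math. J. 99 (1999), §2.1 (the curve space);
G. F. Lawler, O. Schramm, W. Werner, Acta Math. 187 (2001), §2 (parametrisation of initial
segments by a functional of the hull). All [folklore].
-/

noncomputable section

open MeasureTheory Filter Topology Set Metric
open scoped ENNReal unitInterval

namespace Summit.CriticalPhenomena.SAWScalingLimit.Theorems.AxiomsOfLimitMarkov

open Literature.Probability.RandomPlanarGeometry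

/-! ### Generalised inverses `r ↦ sInf {s | r W ≤ f s - f 0}` on the unit interval -/

/-- **(A), abstract form.** For a continuous strictly increasing `f : [0,1] → ℝ` and `W` with
`f s - f 0 < W` for all `s`, the generalised inverse `θ r := sInf {s | r W ≤ f s - f 0}` is a
continuous monotone self-map of `[0, 1]` with `θ 0 = 0` and `θ 1 = 1` (it is monotone and onto,
`θ ((f s - f 0) / W) = s`). [folklore] -/
theorem ClockInverse.exists_theta {f : I → ℝ} (hfm : StrictMono f) {W : ℝ}
    (hW : ∀ s, f s - f 0 < W) :
    ∃ θ : I → I, Continuous θ ∧ Monotone θ ∧ θ 0 = 0 ∧ θ 1 = 1 ∧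
      ∀ r : I, sInf {s : I | (r : ℝ) * W ≤ f s - f 0} = θ r := by
  have hW0 : 0 < W := by simpa using hW 0
  have h0 : ∀ s, 0 ≤ f s - f 0 := fun s => sub_nonneg.2 (hfm.monotone unitInterval.nonneg')
  have hmono : Monotone fun r : I => sInf {s : I | (r : ℝ) * W ≤ f s - f 0} := fun r r' h =>
    sInf_le_sInf fun s (hs : (r' : ℝ) * W ≤ f s - f 0) =>
      (mul_le_mul_of_nonneg_right (Subtype.coe_le_coe.2 h) hW0.le).trans hs
  have hsurj : Function.Surjective fun r : I => sInf {s : I | (r : ℝ) * W ≤ f s - f 0} := by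
    intro s
    refine ⟨⟨(f s - f 0) / W, div_nonneg (h0 s) hW0.le, (div_le_one hW0).2 (hW s).le⟩, ?_⟩
    show sInf {s' : I | (f s - f 0) / W * W ≤ f s' - f 0} = s
    have : {s' : I | (f s - f 0) / W * W ≤ f s' - f 0} = Set.Ici s := Set.ext fun s' => by
      rw [mem_setOf_eq, mem_Ici, div_mul_cancel₀ _ hW0.ne', sub_le_sub_iff_right, hfm.le_iff_le]
    rw [this, csInf_Ici]
  refine ⟨_, hmono.continuous_of_surjective hsurj, hmono, ?_, ?_, fun r => rfl⟩
  · show sInf {s : I | ((0 : I) : ℝ) * W ≤ f s - f 0} = 0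
    have : {s : I | ((0 : I) : ℝ) * W ≤ f s - f 0} = univ := Set.eq_univ_of_forall fun s => by
      rw [mem_setOf_eq, Set.Icc.coe_zero, zero_mul]
      exact h0 s
    rw [this, sInf_univ]
    rfl
  · show sInf {s : I | ((1 : I) : ℝ) * W ≤ f s - f 0} = 1
    have : {s : I | ((1 : I) : ℝ) * W ≤ f s - f 0} = ∅ :=
      Set.eq_empty_of_forall_notMem fun s hs => by
        rw [mem_setOf_eq, Set.Icc.coe_one, one_mul] at hs
        exact (hW s).not_ge hs
    rw [this, sInf_empty]
    rfl

/-- A continuous self-map `ψ` of `[0, 1]` with `ψ 0 = 0`, `ψ 1 = 1` is onto. [folklore] -/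
theorem ClockInverse.surjective_of_map_zero_one {ψ : I → I} (hψc : Continuous ψ) (hψ0 : ψ 0 = 0)
    (hψ1 : ψ 1 = 1) : Function.Surjective ψ := fun t =>
  intermediate_value_univ 0 1 hψc (by
    rw [mem_Icc, hψ0, hψ1]
    exact ⟨unitInterval.nonneg', unitInterval.le_one'⟩)

/-- **(B), abstract form.** A continuous monotone self-map `ψ` of `[0, 1]` fixing `0` and `1`
maps the infimum of the preimage of a closed set `T ⊆ [0, 1]` to the infimum of `T` (both infima
in the complete lattice `[0, 1]`, `sInf ∅ = 1`). [folklore] -/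
theorem ClockInverse.apply_sInf_preimage {ψ : I → I} (hψc : Continuous ψ) (hψm : Monotone ψ)
    (hψ0 : ψ 0 = 0) (hψ1 : ψ 1 = 1) {T : Set I} (hT : IsClosed T) :
    ψ (sInf (ψ ⁻¹' T)) = sInf T := by
  rcases T.eq_empty_or_nonempty with rfl | hne
  · rw [Set.preimage_empty, sInf_empty]
    exact hψ1
  · obtain ⟨s₀, hs₀⟩ := ClockInverse.surjective_of_map_zero_one hψc hψ0 hψ1 (sInf T)
    have hs₀S : s₀ ∈ ψ ⁻¹' T := by
      rw [mem_preimage, hs₀]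
      exact IsClosed.sInf_mem hne hT
    have hmemS : sInf (ψ ⁻¹' T) ∈ ψ ⁻¹' T := IsClosed.sInf_mem ⟨s₀, hs₀S⟩ (hT.preimage hψc)
    exact le_antisymm ((hψm (sInf_le hs₀S)).trans_eq hs₀) (sInf_le hmemS)

/-- **(C), abstract form.** If `g x : [0,1] → ℝ` is monotone for every `x` and `x ↦ g x s` is
measurable for every `s`, then `x ↦ sInf {s | a ≤ g x s - g x 0}` is measurable: the sublevel
set `{x | sInf {…} < b}` is the countable union, over the points `q < b` of a countable dense
subset of `[0, 1]`, of the measurable sets `{x | a ≤ g x q - g x 0}`. [folklore] -/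
theorem ClockInverse.measurable_sInf {X : Type*} [MeasurableSpace X] {g : X → I → ℝ}
    (hmeas : ∀ s, Measurable fun x => g x s) (hmono : ∀ x, Monotone (g x)) (a : ℝ) :
    Measurable fun x => sInf {s : I | a ≤ g x s - g x 0} := by
  obtain ⟨D, hDc, hDd⟩ := TopologicalSpace.exists_countable_dense I
  refine measurable_of_Iio fun b => ?_
  have key : (fun x => sInf {s : I | a ≤ g x s - g x 0}) ⁻¹' Iio b =
      ⋃ q ∈ D, ⋃ (_ : q < b), {x | a ≤ g x q - g x 0} := by
    ext x
    simp only [mem_preimage, mem_Iio, mem_iUnion, mem_setOf_eq, exists_prop]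
    constructor
    · intro h
      obtain ⟨s, hs, hsb⟩ := sInf_lt_iff.1 h
      obtain ⟨q, hqD, hsq, hqb⟩ := hDd.exists_between hsb
      exact ⟨q, hqD, hqb, le_trans hs (sub_le_sub_right (hmono x hsq.le) _)⟩
    · rintro ⟨q, _, hqb, hq⟩
      exact (sInf_le (s := {s : I | a ≤ g x s - g x 0}) hq).trans_lt hqb
  rw [key]
  exact MeasurableSet.biUnion hDc fun q _ => MeasurableSet.iUnion fun _ =>
    measurableSet_le measurable_const ((hmeas q).sub (hmeas 0))

/-! ### The clock along heads: monotone, bounded by the volume, reparametrisation, continuity -/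

/-- The clock `t ↦ ∫ x in closedBall 0 R, exp (-infDist x (γ ∘ affineClamp 0 t).range)` is
nondecreasing along the heads of every curve (the ranges of the heads increase). [folklore] -/
theorem ClockInverse.monotone_integral_head (R : ℝ) (γ : Curve ℂ) :
    Monotone fun t : I => ∫ x in closedBall (0 : ℂ) R,
      Real.exp (-infDist x (⟨γ.toContinuousMap.comp (Curve.affineClamp 0 t)⟩ : Curve ℂ).range) :=
  fun _ _ h => integral_mono (IntrinsicClock.integrableOn_exp_neg_infDist R _)
    (IntrinsicClock.integrableOn_exp_neg_infDist R _) fun _ => Real.exp_le_exp.2 (neg_le_neg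
      (infDist_le_infDist_of_subset (IntrinsicClock.range_head_mono γ h) (Curve.range_nonempty _)))

/-- Clock differences are smaller than the volume `W` of the ball: every clock value is at most
`W` (integrand `≤ 1`) and positive (`R > 0`, positive integrand). [folklore] -/
theorem ClockInverse.integral_sub_integral_lt {R : ℝ} (hR : 0 < R) (K K₀ : Set ℂ) :
    (∫ x in closedBall (0 : ℂ) R, Real.exp (-infDist x K)) -
        (∫ x in closedBall (0 : ℂ) R, Real.exp (-infDist x K₀)) <
      (volume (closedBall (0 : ℂ) R)).toReal := by
  have h1 : (∫ x in closedBall (0 : ℂ) R, Real.exp (-infDist x K)) ≤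
      (volume (closedBall (0 : ℂ) R)).toReal := by
    have hb : ∀ x ∈ closedBall (0 : ℂ) R, ‖Real.exp (-infDist x K)‖ ≤ 1 := fun x _ => by
      rw [Real.norm_eq_abs, abs_of_pos (Real.exp_pos (-infDist x K)), Real.exp_le_one_iff,
        neg_nonpos]
      exact infDist_nonneg
    have h := norm_setIntegral_le_of_norm_le_const
      (measure_closedBall_lt_top (x := (0 : ℂ)) (r := R) (μ := volume)) hb
    rw [one_mul, measureReal_def] at h
    exact (Real.le_norm_self _).trans h
  have h2 : 0 < ∫ x in closedBall (0 : ℂ) R, Real.exp (-infDist x K₀) := by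
    rw [setIntegral_pos_iff_support_of_nonneg_ae (Eventually.of_forall fun x => (Real.exp_pos _).le)
      (IntrinsicClock.integrableOn_exp_neg_infDist R K₀)]
    exact (measure_closedBall_pos volume (0 : ℂ) hR).trans_le
      (measure_mono fun x hx => ⟨Function.mem_support.2 (Real.exp_pos _).ne', hx⟩)
  linarith

/-- The range of a continuous monotone self-map `φ` of `[0, 1]` is `[φ 0, φ 1]`. [folklore] -/
theorem ClockInverse.range_eq_Icc {φ : I → I} (hc : Continuous φ) (hm : Monotone φ) :
    Set.range φ = Set.Icc (φ 0) (φ 1) :=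
  Subset.antisymm
    (Set.range_subset_iff.2 fun _ => ⟨hm unitInterval.nonneg', hm unitInterval.le_one'⟩)
    (intermediate_value_univ 0 1 hc)

/-- **Heads of a reparametrised curve.** For a continuous monotone `ψ` with `ψ 0 = 0`, the head of
`γ ∘ ψ` at `s` has the same range as the head of `γ` at `ψ s` (both are `γ '' [0, ψ s]`).
[folklore] -/
theorem ClockInverse.range_head_comp {E : Type*} [PseudoMetricSpace E] (γ : Curve E)
    {ψ : C(I, I)} (hψm : Monotone ψ) (hψ0 : ψ 0 = 0) (s : I) :
    (⟨(⟨γ.toContinuousMap.comp ψ⟩ : Curve E).toContinuousMap.comp (Curve.affineClamp 0 s)⟩ :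
        Curve E).range =
      (⟨γ.toContinuousMap.comp (Curve.affineClamp 0 (ψ s))⟩ : Curve E).range := by
  rw [IntrinsicClock.range_head, IntrinsicClock.range_head]
  have e1 : (fun u : I => (⟨γ.toContinuousMap.comp ψ⟩ : Curve E) (s * u)) =
      γ ∘ fun u : I => ψ (s * u) := rfl
  have e2 : (fun u : I => γ (ψ s * u)) = γ ∘ fun u : I => ψ s * u := rfl
  have hms : Monotone fun u : I => s * u := fun _ _ h => mul_le_mul_right h s
  have hmψ : Monotone fun u : I => ψ s * u := fun _ _ h => mul_le_mul_right h (ψ s)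
  rw [e1, e2, Set.range_comp, Set.range_comp,
    ClockInverse.range_eq_Icc (φ := fun u : I => ψ (s * u))
      (ψ.continuous.comp (continuous_const.mul continuous_id)) (hψm.comp hms),
    ClockInverse.range_eq_Icc (φ := fun u : I => ψ s * u) (continuous_const.mul continuous_id) hmψ]
  simp only [mul_zero, mul_one, hψ0]

/-- The clock is continuous in the parametrised curve `γ : C([0,1], ℂ)` (sup distance) at every
fixed head parameter `s` (Lipschitz in the class, `IntrinsicClock.continuous_integral`).
[folklore] -/
theorem ClockInverse.continuous_integral_mk (R : ℝ) (s : I) :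
    Continuous fun γ : C(I, ℂ) => ∫ x in closedBall (0 : ℂ) R,
      Real.exp (-infDist x
        (⟨(Curve.mk γ).toContinuousMap.comp (Curve.affineClamp 0 s)⟩ : Curve ℂ).range) := by
  have h1 : Continuous fun γ : C(I, ℂ) =>
      CurveClass.mk (Curve.mk (γ.comp (Curve.affineClamp 0 s))) :=
    CurveClass.continuous_mk_comp_mk.comp (ContinuousMap.continuous_precomp (Curve.affineClamp 0 s))
  refine ((IntrinsicClock.continuous_integral R).comp h1).congr fun γ => ?_
  simp only [Function.comp_apply, CurveClass.range_mk]

/-! ### Assembly -/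

/-- **Λb1, the clock parametrisation** (crux `AxiomsOfLimit`, registered stub `stub_clockInverse`):
for `R > 0`, `W := volume (closedBall 0 R)`, the clock `clk γ s` of the head `γ|[0, s]` and
`Λ γ r := γ (sInf {s | r W ≤ clk γ s - clk γ 0})`:
(A) for a simple curve in `ball 0 R`, `Λ γ = γ ∘ θ` for a continuous monotone `θ : [0,1] → [0,1]`
with `θ 0 = 0`, `θ 1 = 1`; (B) `Λ` is invariant under continuous monotone reparametrisations
fixing the endpoints; (C) `γ ↦ Λ γ r` is Borel on `C([0,1], ℂ)` for every `r`. [folklore] -/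
theorem stub_clockInverse : ∀ (R : ℝ), 0 < R → let W : ℝ := (MeasureTheory.volume (Metric.closedBall (0:ℂ) R)).toReal; let clk : Literature.Probability.RandomPlanarGeometry.Curve ℂ → unitInterval → ℝ := fun γ s => ∫ x in Metric.closedBall (0:ℂ) R, Real.exp (-Metric.infDist x (⟨(γ).toContinuousMap.comp (Literature.Probability.RandomPlanarGeometry.Curve.affineClamp 0 s)⟩ : Literature.Probability.RandomPlanarGeometry.Curve ℂ).range); let Λ : Literature.Probability.RandomPlanarGeometry.Curve ℂ → unitInterval → ℂ := fun γ r => γ (sInf {s : unitInterval | (r : ℝ) * W ≤ clk γ s - clk γ 0}); (∀ γ : Literature.Probability.RandomPlanarGeometry.Curve ℂ, Function.Injective γ → γ.range ⊆ Metric.ball (0:ℂ) R → ∃ θ : unitInterval → unitInterval, Continuous θ ∧ Monotone θ ∧ θ 0 = 0 ∧ θ 1 = 1 ∧ ∀ r : unitInterval, Λ γ r = γ (θ r)) ∧ (∀ γ : Literature.Probability.RandomPlanarGeometry.Curve ℂ, Function.Injective γ → γ.range ⊆ Metric.ball (0:ℂ) R → ∀ ψ : C(unitInterval, unitInterval), Monotone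 ψ → ψ 0 = 0 → ψ 1 = 1 → ∀ r : unitInterval, Λ ⟨γ.toContinuousMap.comp ψ⟩ r = Λ γ r) ∧ (∀ [MeasurableSpace C(unitInterval, ℂ)] [BorelSpace C(unitInterval, ℂ)] (r : unitInterval), Measurable (fun γ : C(unitInterval, ℂ) => Λ (Literature.Probability.RandomPlanarGeometry.Curve.mk γ) r)) := by
  intro R hR W clk Λ
  have hcont : ∀ γ : Curve ℂ, Continuous (clk γ) := fun γ =>
    IntrinsicClock.continuous_integral_head R γ
  have hmono : ∀ γ : Curve ℂ, Monotone (clk γ) := fun γ => ClockInverse.monotone_integral_head R γ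
  have hlt : ∀ (γ : Curve ℂ) (s : I), clk γ s - clk γ 0 < W := fun γ s =>
    ClockInverse.integral_sub_integral_lt hR _ _
  refine ⟨fun γ hγ hγR => ?_, fun γ _ _ ψ hψm hψ0 hψ1 r => ?_, ?_⟩
  · -- (A)
    obtain ⟨θ, h1, h2, h3, h4, h5⟩ := ClockInverse.exists_theta (f := clk γ)
      (IntrinsicClock.strictMono_integral_head γ hγ hγR) (hlt γ)
    exact ⟨θ, h1, h2, h3, h4, fun r => congrArg γ (h5 r)⟩
  · -- (B)
    have hc : ∀ s, clk ⟨γ.toContinuousMap.comp ψ⟩ s = clk γ (ψ s) := fun s =>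
      congrArg (fun K : Set ℂ => ∫ x in closedBall (0 : ℂ) R, Real.exp (-infDist x K))
        (ClockInverse.range_head_comp γ hψm hψ0 s)
    have hS : {s : I | (r : ℝ) * W ≤ clk ⟨γ.toContinuousMap.comp ψ⟩ s -
        clk ⟨γ.toContinuousMap.comp ψ⟩ 0} = ψ ⁻¹' {t : I | (r : ℝ) * W ≤ clk γ t - clk γ 0} :=
      Set.ext fun s => by rw [mem_setOf_eq, hc, hc, hψ0]; rfl
    show (⟨γ.toContinuousMap.comp ψ⟩ : Curve ℂ) (sInf {s : I | (r : ℝ) * W ≤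
        clk ⟨γ.toContinuousMap.comp ψ⟩ s - clk ⟨γ.toContinuousMap.comp ψ⟩ 0}) =
      γ (sInf {t : I | (r : ℝ) * W ≤ clk γ t - clk γ 0})
    have hT : IsClosed {t : I | (r : ℝ) * W ≤ clk γ t - clk γ 0} :=
      isClosed_le continuous_const ((hcont γ).sub continuous_const)
    rw [hS, ← ClockInverse.apply_sInf_preimage ψ.continuous hψm hψ0 hψ1 hT]
    rfl
  · -- (C)
    intro _ _ r
    have hc : ∀ s : I, Continuous fun γ : C(I, ℂ) => clk (Curve.mk γ) s := fun s =>
      ClockInverse.continuous_integral_mk R s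
    have hθ : Measurable fun γ : C(I, ℂ) =>
        sInf {s : I | (r : ℝ) * W ≤ clk (Curve.mk γ) s - clk (Curve.mk γ) 0} :=
      ClockInverse.measurable_sInf (g := fun γ s => clk (Curve.mk γ) s)
        (fun s => (hc s).measurable) (fun γ => hmono (Curve.mk γ)) _
    exact continuous_eval.measurable.comp (measurable_id.prodMk hθ)

end Summit.CriticalPhenomena.SAWScalingLimit.Theorems.AxiomsOfLimitMarkov
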